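import Summits.Ventures.HodgeRepro.TwistedQuadAllInst
import Summits.Ventures.HodgeRepro.TwistedQuadK8K12

/-!
# Route-2's Theorem S (the twisted segment), `SD` form, for EVERY `k ≡ 4 (mod 8)` — one kernel theorem

Blind re-derivation cell `pub-hodge-repro`, seat `p1` (gen 12).  Route-2's Theorem S (INBOX L1177, ROUTE-B §9.17)
is the twisted segment `Δ_S = {1, v, v², u}` for `v` of order `2k`, `v^k = c`, an involution `u ∉ ⟨v⟩` with
`u v u⁻¹ = v^{k−1} = c v⁻¹`; `TwistedQuad16` / `TwistedQuadK8K12` put `k = 4, 12` on the kernel by decided models.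
Writing `k = 2j`, the model is `TwistedQuadAllNeg`'s `ℤ/4j ⋊_{2j−1} ℤ/2`.  The seat's enumeration found that the
`k = 12` witness is 8-PERIODIC — `f₀(n) = [n mod 8 ∈ {2, 4, 5, 7}]` on `⟨v⟩`, `f₁(n) = [n mod 8 < 4]` on the `u`-coset
— and that this family works exactly when `k ≡ 4 (mod 8)` (verified `k = 4, 12, 20, 28, 36, 44`; fails `k ≡ 0 (mod 8)`),
which explains route-2's congruence condition.  Here the three local conditions are proved for every `j ≡ 2 (mod 4)`
(all arithmetic is `mod 8`: `4j ≡ 0`, `2j ≡ 4`; the 16 conjugate pairs are separated by the points `1, v, v², v⁵`),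
and `exists_quad_of_model` transports: `exists_segmentQuad_SD_all`.
-/

set_option autoImplicit false

open Finset Multiplicative
open scoped Pointwise

namespace HodgeRepro.TwistedQuadGen

open HodgeRepro.CosetQuad

variable (j : ℕ) [NeZero j]

/-! ### Value arithmetic in `ℤ/4j` -/

omit [NeZero j] in
/-- `−2 = ((4j − 2 : ℕ) : ℤ/4j)`. -/
theorem seg_neg_two_cast (hj : 1 ≤ j) : (-2 : ZMod (4 * j)) = ((4 * j - 2 : ℕ) : ZMod (4 * j)) := by
  have h2 : (2 : ZMod (4 * j)) = ((2 : ℕ) : ZMod (4 * j)) := by norm_num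
  symm
  apply eq_neg_of_add_eq_zero_left
  rw [h2, ← Nat.cast_add, show 4 * j - 2 + 2 = 4 * j by omega, neg_four_j_cast]

/-- `(a − 2).val`. -/
theorem seg_val_sub_two (hj : 1 ≤ j) (a : ZMod (4 * j)) :
    (a - 2).val = if a.val < 2 then a.val + 4 * j - 2 else a.val - 2 := by
  obtain ⟨i, hi, rfl⟩ := neg_exists_natCast_eq j a
  rw [sub_eq_add_neg, seg_neg_two_cast j hj, ← Nat.cast_add, val_natCast_lt _ hi]
  split_ifs with h
  · rw [val_natCast_lt _ (by omega)]; omega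
  · rw [val_natCast_sub _ (by omega) (by omega)]; omega

/-- `(a + 2).val`. -/
theorem seg_val_add_two (a : ZMod (4 * j)) :
    (a + 2).val = if a.val + 2 < 4 * j then a.val + 2 else a.val + 2 - 4 * j := by
  obtain ⟨i, hi, rfl⟩ := neg_exists_natCast_eq j a
  have h2 : (2 : ZMod (4 * j)) = ((2 : ℕ) : ZMod (4 * j)) := by norm_num
  rw [val_natCast_lt _ hi, h2, ← Nat.cast_add]
  split_ifs with h
  · exact val_natCast_lt _ h
  · rw [val_natCast_sub _ (by omega) (by omega)]

omit [NeZero j] in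
/-- `s · (−2) = 2` for `s = 2j − 1`. -/
theorem sNeg_mul_neg_two (hj : 1 ≤ j) : sNeg j * (-2) = 2 := by
  have h2 : (2 : ZMod (4 * j)) = ((2 : ℕ) : ZMod (4 * j)) := by norm_num
  rw [mul_neg, sNeg, h2, ← Nat.cast_mul, show (2 * j - 1) * 2 = 4 * j - 2 by omega,
    ← seg_neg_two_cast j hj, neg_neg, ← h2]

/-! ### The segment and its inverses in coordinates -/

/-- `v² = mk 2 0`. -/
theorem tv_sq_eq_mk : tv (4 * j) (sNeg j) (sNeg_sq j) ^ 2 = mk (4 * j) (sNeg j) (sNeg_sq j) 2 0 := by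
  rw [pow_two, tv_eq_mk, mk_mul, ZMod.val_zero, pow_zero, one_mul, add_zero, one_add_one_eq_two]

/-- The inverses of `1, v, v², u`. -/
theorem segSD_inv :
    (segSD (4 * j) (sNeg j) (sNeg_sq j) 0)⁻¹ = mk (4 * j) (sNeg j) (sNeg_sq j) 0 0 ∧
    (segSD (4 * j) (sNeg j) (sNeg_sq j) 1)⁻¹ = mk (4 * j) (sNeg j) (sNeg_sq j) (-1) 0 ∧
    (segSD (4 * j) (sNeg j) (sNeg_sq j) 2)⁻¹ = mk (4 * j) (sNeg j) (sNeg_sq j) (-2) 0 ∧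
    (segSD (4 * j) (sNeg j) (sNeg_sq j) 3)⁻¹ = mk (4 * j) (sNeg j) (sNeg_sq j) 0 1 := by
  refine ⟨?_, ?_, ?_, ?_⟩
  · show (1 : TwistGroup (4 * j) (sNeg j) (sNeg_sq j))⁻¹ = mk (4 * j) (sNeg j) (sNeg_sq j) 0 0
    rw [inv_one, one_eq_mk]
  · exact tv_inv _ _ _
  · show (tv (4 * j) (sNeg j) (sNeg_sq j) ^ 2)⁻¹ = mk (4 * j) (sNeg j) (sNeg_sq j) (-2) 0
    rw [tv_sq_eq_mk]
    apply inv_eq_of_mul_eq_one_right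
    rw [mk_mul, ZMod.val_zero, pow_zero, one_mul, add_neg_cancel, add_zero, one_eq_mk]
  · exact tu_inv _ _ _

/-- The four neighbours of a `⟨v⟩`-point: `mk a 0, mk (a − 1) 0, mk (a − 2) 0, mk a 1`. -/
theorem seg_nbrs_zero (a : ZMod (4 * j)) :
    mk (4 * j) (sNeg j) (sNeg_sq j) a 0 * (segSD (4 * j) (sNeg j) (sNeg_sq j) 0)⁻¹ =
      mk (4 * j) (sNeg j) (sNeg_sq j) a 0 ∧
    mk (4 * j) (sNeg j) (sNeg_sq j) a 0 * (segSD (4 * j) (sNeg j) (sNeg_sq j) 1)⁻¹ =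
      mk (4 * j) (sNeg j) (sNeg_sq j) (a - 1) 0 ∧
    mk (4 * j) (sNeg j) (sNeg_sq j) a 0 * (segSD (4 * j) (sNeg j) (sNeg_sq j) 2)⁻¹ =
      mk (4 * j) (sNeg j) (sNeg_sq j) (a - 2) 0 ∧
    mk (4 * j) (sNeg j) (sNeg_sq j) a 0 * (segSD (4 * j) (sNeg j) (sNeg_sq j) 3)⁻¹ =
      mk (4 * j) (sNeg j) (sNeg_sq j) a 1 := by
  obtain ⟨i0, i1, i2, i3⟩ := segSD_inv j
  refine ⟨?_, ?_, ?_, ?_⟩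
  · rw [i0, mk_mul, ZMod.val_zero, pow_zero, one_mul, add_zero, add_zero]
  · rw [i1, mk_mul, ZMod.val_zero, pow_zero, one_mul, add_zero, sub_eq_add_neg]
  · rw [i2, mk_mul, ZMod.val_zero, pow_zero, one_mul, add_zero, sub_eq_add_neg]
  · rw [i3, mk_mul, ZMod.val_zero, pow_zero, one_mul, add_zero, zero_add]

/-- The four neighbours of a `u`-coset point: `mk a 1, mk (a − s) 1, mk (a + 2) 1, mk a 0`. -/
theorem seg_nbrs_one (hj : 1 ≤ j) (a : ZMod (4 * j)) :
    mk (4 * j) (sNeg j) (sNeg_sq j) a 1 * (segSD (4 * j) (sNeg j) (sNeg_sq j) 0)⁻¹ =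
      mk (4 * j) (sNeg j) (sNeg_sq j) a 1 ∧
    mk (4 * j) (sNeg j) (sNeg_sq j) a 1 * (segSD (4 * j) (sNeg j) (sNeg_sq j) 1)⁻¹ =
      mk (4 * j) (sNeg j) (sNeg_sq j) (a - sNeg j) 1 ∧
    mk (4 * j) (sNeg j) (sNeg_sq j) a 1 * (segSD (4 * j) (sNeg j) (sNeg_sq j) 2)⁻¹ =
      mk (4 * j) (sNeg j) (sNeg_sq j) (a + 2) 1 ∧
    mk (4 * j) (sNeg j) (sNeg_sq j) a 1 * (segSD (4 * j) (sNeg j) (sNeg_sq j) 3)⁻¹ =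
      mk (4 * j) (sNeg j) (sNeg_sq j) a 0 := by
  obtain ⟨i0, i1, i2, i3⟩ := segSD_inv j
  refine ⟨?_, ?_, ?_, ?_⟩
  · rw [i0, mk_mul, val_one_two, pow_one, mul_zero, add_zero, add_zero]
  · rw [i1, mk_mul, val_one_two, pow_one, mul_neg_one, ← sub_eq_add_neg, add_zero]
  · rw [i2, mk_mul, val_one_two, pow_one, sNeg_mul_neg_two j hj, add_zero]
  · rw [i3, mk_mul, val_one_two, pow_one, mul_zero, add_zero, two_zmod_two]

/-! ### The pattern -/

/-- `f₀(n) = [n mod 8 ∈ {2, 4, 5, 7}]`. -/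
def seg0 (n : ℕ) : Prop := n % 8 = 2 ∨ n % 8 = 4 ∨ n % 8 = 5 ∨ n % 8 = 7

/-- `f₁(n) = [n mod 8 < 4]`. -/
def seg1 (n : ℕ) : Prop := n % 8 < 4

/-- The predicate `seg0` is decidable. -/
instance : DecidablePred seg0 := fun n => by unfold seg0; infer_instance
/-- The predicate `seg1` is decidable. -/
instance : DecidablePred seg1 := fun n => by unfold seg1; infer_instance

/-- The pattern on the model. -/
def segPat (p : TwistGroup (4 * j) (sNeg j) (sNeg_sq j)) : Prop :=
  (p.right = ofAdd 0 ∧ seg0 (toAdd p.left).val) ∨ (p.right = ofAdd 1 ∧ seg1 (toAdd p.left).val)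

/-- The predicate `(segPat j)` is decidable. -/
instance : DecidablePred (segPat j) := fun p => by unfold segPat; infer_instance

/-- The CM type of the model. -/
def ΦS : Finset (TwistGroup (4 * j) (sNeg j) (sNeg_sq j)) := univ.filter (segPat j)

/-- Membership on the `⟨v⟩`-layer. -/
theorem mem_ΦS_zero (a : ZMod (4 * j)) : mk (4 * j) (sNeg j) (sNeg_sq j) a 0 ∈ ΦS j ↔ seg0 a.val := by
  rw [ΦS, Finset.mem_filter]
  have h01 : (ofAdd (0 : ZMod 2) : Multiplicative (ZMod 2)) ≠ ofAdd 1 := by decide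
  simp only [Finset.mem_univ, true_and, segPat, mk, toAdd_ofAdd, h01, false_and, or_false]

/-- Membership on the `u`-coset. -/
theorem mem_ΦS_one (a : ZMod (4 * j)) : mk (4 * j) (sNeg j) (sNeg_sq j) a 1 ∈ ΦS j ↔ seg1 a.val := by
  rw [ΦS, Finset.mem_filter]
  have h10 : (ofAdd (1 : ZMod 2) : Multiplicative (ZMod 2)) ≠ ofAdd 0 := by decide
  simp only [Finset.mem_univ, true_and, segPat, mk, toAdd_ofAdd, h10, false_and, false_or]

/-! ### The three local conditions (`j ≡ 2 (mod 4)`) -/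

/-- CM: `p c ∈ Φ ↔ p ∉ Φ`. -/
theorem seg_cm (hj : j % 4 = 2) (p : TwistGroup (4 * j) (sNeg j) (sNeg_sq j)) :
    p * tc (4 * j) (sNeg j) (sNeg_sq j) ∈ ΦS j ↔ ¬ p ∈ ΦS j := by
  obtain ⟨l, r⟩ := p
  obtain ⟨a, rfl⟩ := ofAdd.surjective l
  obtain ⟨g, rfl⟩ := ofAdd.surjective r
  show mk (4 * j) (sNeg j) (sNeg_sq j) a g * tc (4 * j) (sNeg j) (sNeg_sq j) ∈ ΦS j ↔
    ¬ mk (4 * j) (sNeg j) (sNeg_sq j) a g ∈ ΦS j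
  rw [mk_mul_tc_neg]
  have hv : a.val < 4 * j := ZMod.val_lt a
  have hh := neg_val_add_half j a
  rcases (show ∀ y : ZMod 2, y = 0 ∨ y = 1 by decide) g with rfl | rfl
  · rw [mem_ΦS_zero, mem_ΦS_zero, hh]
    unfold seg0
    split_ifs <;> omega
  · rw [mem_ΦS_one, mem_ΦS_one, hh]
    unfold seg1
    split_ifs <;> omega

/-- SumTwo: exactly two of the four neighbours of every point lie in `Φ`. -/
theorem seg_sumTwo (hj : j % 4 = 2) (p : TwistGroup (4 * j) (sNeg j) (sNeg_sq j)) :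
    (univ.filter fun i : Fin 4 => p * (segSD (4 * j) (sNeg j) (sNeg_sq j) i)⁻¹ ∈ ΦS j).card = 2 := by
  have hj1 : 1 ≤ j := by omega
  obtain ⟨l, r⟩ := p
  obtain ⟨a, rfl⟩ := ofAdd.surjective l
  obtain ⟨g, rfl⟩ := ofAdd.surjective r
  have e : (⟨ofAdd a, ofAdd g⟩ : TwistGroup (4 * j) (sNeg j) (sNeg_sq j)) = mk (4 * j) (sNeg j) (sNeg_sq j) a g := rfl
  rw [e, Finset.card_filter, Fin.sum_univ_four]
  have hv : a.val < 4 * j := ZMod.val_lt a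
  have h1 := neg_val_sub_one j hj1 a
  have h2 := seg_val_sub_two j hj1 a
  have h3 := val_sub_sNeg j hj1 a
  have h4 := seg_val_add_two j a
  rcases (show ∀ y : ZMod 2, y = 0 ∨ y = 1 by decide) g with rfl | rfl
  · obtain ⟨n0, n1, n2, n3⟩ := seg_nbrs_zero j a
    simp only [n0, n1, n2, n3, mem_ΦS_zero, mem_ΦS_one, seg0, seg1, h1, h2]
    split_ifs <;> omega
  · obtain ⟨n0, n1, n2, n3⟩ := seg_nbrs_one j hj1 a
    simp only [n0, n1, n2, n3, mem_ΦS_zero, mem_ΦS_one, seg0, seg1, h3, h4]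
    split_ifs <;> omega

/-- The neighbour memberships of a `⟨v⟩`-point, as predicates. -/
def segMk (i : Fin 4) (a : ZMod (4 * j)) : Prop :=
  match i with
  | 0 => seg0 a.val
  | 1 => seg0 (a - 1).val
  | 2 => seg0 (a - 2).val
  | 3 => seg1 a.val

/-- `seg_nbrs_zero` as memberships. -/
theorem seg_mem_nbr (a : ZMod (4 * j)) (i : Fin 4) :
    mk (4 * j) (sNeg j) (sNeg_sq j) a 0 * (segSD (4 * j) (sNeg j) (sNeg_sq j) i)⁻¹ ∈ ΦS j ↔ segMk j i a := by
  obtain ⟨n0, n1, n2, n3⟩ := seg_nbrs_zero j a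
  have hfin : ∀ x : Fin 4, x = 0 ∨ x = 1 ∨ x = 2 ∨ x = 3 := by decide
  rcases hfin i with rfl | rfl | rfl | rfl
  · rw [n0, mem_ΦS_zero]; exact Iff.rfl
  · rw [n1, mem_ΦS_zero]; exact Iff.rfl
  · rw [n2, mem_ΦS_zero]; exact Iff.rfl
  · rw [n3, mem_ΦS_one]; exact Iff.rfl

/-- A `⟨v⟩`-point where the memberships `Φ t_k`, `Φ t_i` AGREE refutes the conjugate pair `(i, k)`. -/
theorem seg_sep_of (hj : j % 4 = 2) (a : ZMod (4 * j)) (i k : Fin 4) (h : segMk j k a ↔ segMk j i a) :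
    ¬ ∀ q : TwistGroup (4 * j) (sNeg j) (sNeg_sq j),
      (q * (segSD (4 * j) (sNeg j) (sNeg_sq j) k)⁻¹ ∈ ΦS j ↔
        q * (tc (4 * j) (sNeg j) (sNeg_sq j) * (segSD (4 * j) (sNeg j) (sNeg_sq j) i)⁻¹) ∈ ΦS j) := by
  intro hall
  have hc : ∀ q : TwistGroup (4 * j) (sNeg j) (sNeg_sq j),
      q * (tc (4 * j) (sNeg j) (sNeg_sq j) * (segSD (4 * j) (sNeg j) (sNeg_sq j) i)⁻¹) =
        (q * (segSD (4 * j) (sNeg j) (sNeg_sq j) i)⁻¹) * tc (4 * j) (sNeg j) (sNeg_sq j) := by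
    intro q
    rw [← mul_assoc, mul_assoc q, (isComplexConj_tc_gen j (by omega) _ _ (sNeg_mul_half j)).comm, ← mul_assoc]
  have := hall (mk (4 * j) (sNeg j) (sNeg_sq j) a 0)
  rw [hc, seg_cm j hj, seg_mem_nbr, seg_mem_nbr] at this
  by_cases hi : segMk j i a
  · exact (this.mp (h.mpr hi)) hi
  · exact hi (h.mp (this.mpr hi))

/-- The values of the witness points `0, 1, 2, 5` and their predecessors. -/
theorem seg_witness_vals (hj : j % 4 = 2) :
    ((0 : ZMod (4 * j)).val = 0 ∧ ((0 : ZMod (4 * j)) - 1).val = 4 * j - 1 ∧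
      ((0 : ZMod (4 * j)) - 2).val = 4 * j - 2) ∧
    (((1 : ℕ) : ZMod (4 * j)).val = 1 ∧ (((1 : ℕ) : ZMod (4 * j)) - 1).val = 0 ∧
      (((1 : ℕ) : ZMod (4 * j)) - 2).val = 4 * j - 1) ∧
    (((2 : ℕ) : ZMod (4 * j)).val = 2 ∧ (((2 : ℕ) : ZMod (4 * j)) - 1).val = 1 ∧
      (((2 : ℕ) : ZMod (4 * j)) - 2).val = 0) ∧
    (((5 : ℕ) : ZMod (4 * j)).val = 5 ∧ (((5 : ℕ) : ZMod (4 * j)) - 1).val = 4 ∧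
      (((5 : ℕ) : ZMod (4 * j)) - 2).val = 3) := by
  have hj1 : 1 ≤ j := by omega
  have h0 : (0 : ZMod (4 * j)).val = 0 := ZMod.val_zero
  have h1 : ((1 : ℕ) : ZMod (4 * j)).val = 1 := val_natCast_lt _ (by omega)
  have h2 : ((2 : ℕ) : ZMod (4 * j)).val = 2 := val_natCast_lt _ (by omega)
  have h5 : ((5 : ℕ) : ZMod (4 * j)).val = 5 := val_natCast_lt _ (by omega)
  refine ⟨⟨h0, ?_, ?_⟩, ⟨h1, ?_, ?_⟩, ⟨h2, ?_, ?_⟩, ⟨h5, ?_, ?_⟩⟩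
  · rw [neg_val_sub_one j hj1, h0, if_pos rfl]
  · rw [seg_val_sub_two j hj1, h0, if_pos (by omega)]; omega
  · rw [neg_val_sub_one j hj1, h1, if_neg (by omega)]
  · rw [seg_val_sub_two j hj1, h1, if_pos (by omega)]; omega
  · rw [neg_val_sub_one j hj1, h2, if_neg (by omega)]
  · rw [seg_val_sub_two j hj1, h2, if_neg (by omega)]
  · rw [neg_val_sub_one j hj1, h5, if_neg (by omega)]
  · rw [seg_val_sub_two j hj1, h5, if_neg (by omega)]

/-- No conjugate pair: one of the points `1, v, v², v⁵` has equal memberships `Φ t_k`, `Φ t_i`. -/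
theorem seg_noConj (hj : j % 4 = 2) (i k : Fin 4) :
    ¬ ∀ q : TwistGroup (4 * j) (sNeg j) (sNeg_sq j),
      (q * (segSD (4 * j) (sNeg j) (sNeg_sq j) k)⁻¹ ∈ ΦS j ↔
        q * (tc (4 * j) (sNeg j) (sNeg_sq j) * (segSD (4 * j) (sNeg j) (sNeg_sq j) i)⁻¹) ∈ ΦS j) := by
  obtain ⟨⟨a0, b0, c0⟩, ⟨a1, b1, c1⟩, ⟨a2, b2, c2⟩, ⟨a5, b5, c5⟩⟩ := seg_witness_vals j hj
  have hfin : ∀ x : Fin 4, x = 0 ∨ x = 1 ∨ x = 2 ∨ x = 3 := by decide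
  -- memberships at the points 0, 1, 2, 5: (F,T,F,T), (F,F,T,T), (T,F,F,T), (T,T,F,F)
  have w0 : ¬ segMk j 0 0 ∧ segMk j 1 0 ∧ ¬ segMk j 2 0 ∧ segMk j 3 0 := by
    simp only [segMk]; unfold seg0 seg1; rw [a0, b0, c0]; omega
  have w1 : ¬ segMk j 0 ((1 : ℕ) : ZMod (4 * j)) ∧ ¬ segMk j 1 ((1 : ℕ) : ZMod (4 * j)) ∧
      segMk j 2 ((1 : ℕ) : ZMod (4 * j)) ∧ segMk j 3 ((1 : ℕ) : ZMod (4 * j)) := by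
    simp only [segMk]; unfold seg0 seg1; rw [a1, b1, c1]; omega
  have w2 : segMk j 0 ((2 : ℕ) : ZMod (4 * j)) ∧ ¬ segMk j 1 ((2 : ℕ) : ZMod (4 * j)) ∧
      ¬ segMk j 2 ((2 : ℕ) : ZMod (4 * j)) ∧ segMk j 3 ((2 : ℕ) : ZMod (4 * j)) := by
    simp only [segMk]; unfold seg0 seg1; rw [a2, b2, c2]; omega
  have w5 : segMk j 0 ((5 : ℕ) : ZMod (4 * j)) ∧ segMk j 1 ((5 : ℕ) : ZMod (4 * j)) ∧
      ¬ segMk j 2 ((5 : ℕ) : ZMod (4 * j)) ∧ ¬ segMk j 3 ((5 : ℕ) : ZMod (4 * j)) := by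
    simp only [segMk]; unfold seg0 seg1; rw [a5, b5, c5]; omega
  obtain ⟨p0, p1, p2, p3⟩ := w0
  obtain ⟨q0, q1, q2, q3⟩ := w1
  obtain ⟨r0, r1, r2, r3⟩ := w2
  obtain ⟨t0, t1, t2, t3⟩ := w5
  rcases hfin i with rfl | rfl | rfl | rfl <;> rcases hfin k with rfl | rfl | rfl | rfl
  · exact seg_sep_of j hj 0 0 0 Iff.rfl
  · exact seg_sep_of j hj _ 0 1 (iff_of_true t1 t0)
  · exact seg_sep_of j hj 0 0 2 (iff_of_false p2 p0)
  · exact seg_sep_of j hj _ 0 3 (iff_of_true r3 r0)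
  · exact seg_sep_of j hj _ 1 0 (iff_of_true t0 t1)
  · exact seg_sep_of j hj 0 1 1 Iff.rfl
  · exact seg_sep_of j hj _ 1 2 (iff_of_false r2 r1)
  · exact seg_sep_of j hj 0 1 3 (iff_of_true p3 p1)
  · exact seg_sep_of j hj 0 2 0 (iff_of_false p0 p2)
  · exact seg_sep_of j hj _ 2 1 (iff_of_false r1 r2)
  · exact seg_sep_of j hj 0 2 2 Iff.rfl
  · exact seg_sep_of j hj _ 2 3 (iff_of_true q3 q2)
  · exact seg_sep_of j hj _ 3 0 (iff_of_true r0 r3)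
  · exact seg_sep_of j hj 0 3 1 (iff_of_true p1 p3)
  · exact seg_sep_of j hj _ 3 2 (iff_of_true q2 q3)
  · exact seg_sep_of j hj 0 3 3 Iff.rfl

/-! ### The theorem -/

/-- **Theorem S, `SD` form, for EVERY `k = 2j ≡ 4 (mod 8)` (route-2 §9.17; kernel existence).**  For every finite
`(G, c)`, `v` of order `4j` with `v^{2j} = c` and an involution `u ∉ ⟨v⟩` with `u v u⁻¹ = v^{2j−1}` (`= c v⁻¹`): some
CM type has the twisted segment `Φ, Φv, Φv², Φu` `SumTwo` without a conjugate pair. -/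
theorem exists_segmentQuad_SD_all {G : Type*} [Group G] [Fintype G] [DecidableEq G] (hj : j % 4 = 2) {c : G}
    (hc : IsComplexConj c) (v u : G) (hv : orderOf v = 4 * j) (hu : u ^ 2 = 1)
    (huv : u * v * u⁻¹ = v ^ (2 * j - 1)) (hnot : u ∉ Subgroup.zpowers v) (hcj : v ^ (2 * j) = c) :
    ∃ Φ : Finset G, IsCMType c Φ ∧ SumTwo (fun i => rmul Φ (![1, v, v ^ 2, u] i)) ∧
      ∀ i k : Fin 4, rmul Φ (![1, v, v ^ 2, u] k) ≠ c • rmul Φ (![1, v, v ^ 2, u] i) := by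
  have hvm : v ^ (4 * j) = 1 := by rw [← hv]; exact pow_orderOf_eq_one v
  have huv' : u * v * u⁻¹ = v ^ (sNeg j).val := by rw [sNeg_val j (by omega)]; exact huv
  obtain ⟨Φ, g1, g2, g3⟩ := exists_quad_of_model (4 * j) (modelHom (4 * j) (hs := sNeg_sq j) v u hvm hu huv')
    (modelHom_injective (4 * j) v u hvm hu huv' hv hnot) hc
    (by rw [modelHom_tc, show 4 * j / 2 = 2 * j by omega]; exact hcj) (segSD (4 * j) (sNeg j) (sNeg_sq j)) (ΦS j)
    (fun p => (decide_eq_decide.mpr (seg_cm j hj p)).trans decide_not)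
    (fun p => by simp only [decide_eq_true_eq]; exact seg_sumTwo j hj p)
    (fun i k h => seg_noConj j hj i k (fun p => by simpa only [decide_eq_true_eq] using h p))
  simp only [modelHom_segSD (4 * j) (by omega : 1 < 4 * j)] at g2 g3
  exact ⟨Φ, g1, g2, g3⟩

end HodgeRepro.TwistedQuadGen
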